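/-
Copyright: cell `langlands-arthur-audit` (papers/Langlands/langlands-arthur-audit), units `pub-arthur-typer`
(gen 1, 2026-08-18T14:35Z) and `pub-arthur-typer-g2` (this tree version).  Staged for the tree under
`Literature/NumberTheory/Automorphic/Arthur2013/` (LEAN-IN-TREE rule 2026-08-18) from the cell module
`HOME/lean/ArthurAudit/ArthurAudit/Leaves.lean` (core Lean): namespace renamed, `import HarnessLib` added for the
gate's audit commands, one provenance tag per declaration, every quotation re-verified against the staged TeX
sources (two gen-1 misquotations corrected: CITED-FACTS TY-1, GAPS G-TY-5), the 2026 status TABLE removed (the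
cell keeps ONE table: module `Upstream`), the local classification statement and the complex-place findings added.
-/
import HarnessLib

/-!
# Arthur (2013), *The Endoscopic Classification of Representations* — typed statement-level content of the load-bearing leaves

**Sources reproduced, and what of them.**  J. Arthur, *The Endoscopic Classification of Representations:
Orthogonal and Symplectic Groups*, AMS Colloquium Publications 61 (2013) [cite: Arthur2013] — "the Book" — is
NOT HELD by the auditing cell (acq-04129): every `[Ar, x.y.z]` locator below is SECOND-HAND, taken from one of
the held texts that track the Book result by result, and marked `(restated in …)`.  Held and quoted VERBATIM
with line/page loci: Atobe–Gan–Ichino–Kaletha–Mínguez–Shin, *Local intertwining relations and co-tempered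
A-packets of classical groups*, arXiv:2410.13504v3 (2026) [AGIKMS] — a PREPRINT under review, TeX source
`note30.tex`; C. P. Mok, *Endoscopic classification of representations of quasi-split unitary groups*, Mem. AMS
235 (2015) = arXiv:1206.0882 [Mok], `main.tex`; Kaletha–Mínguez–Shin–White, arXiv:1409.3731v3 [KMSW];
Mœglin–Waldspurger, *Stabilisation de la formule des traces tordue*, Progress in Math. 316/317 (2016) read as the
arXiv parts I (1401.4569), II (1401.7127), VII (1409.0960), X (1412.2981) [MW I, II, VII, X]; Chaudouard–Laumon,
*Le lemme fondamental pondéré II*, Ann. of Math. 176 (2012) = arXiv:0912.4512 [CL II] (TeX, latin-1);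
Waldspurger, *Endoscopie et changement de caractéristique : intégrales orbitales pondérées*, Ann. Inst. Fourier
59 (2009) [W-AIF] (held PDF, corpus key `paper:doi-10-5802-aif-2476`); Cluckers–Hales–Loeser, *Transfer
principle for the fundamental lemma*, arXiv:0712.0708 [CHL] (held); Arthur's TIFR survey *The endoscopic
classification of representations* [TIFR] (held PDF, corpus key `paper:url-560716e7679e`; survey wording).
HELD since 2026-08-18 and typed FIRST-HAND in module `Leaves/W4` (same directory; §2.1 hypotheses, Conj. 3.5,
3.6, 3.7, Thm 3.8 with its §6 proof skeleton, verbatim French with journal pages): Waldspurger, *À propos du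
lemme fondamental pondéré tordu*, Math. Ann. 343 (2009) 103–174 [W4] (acq-07646 fulfilled; cell file
`inputs/files/waldspurger2009-lemme-fondamental-pondere-tordu-MathAnn343.txt`) — in THIS module and in
`WeightedFL`/`Register` its statements are still carried through the held restatements ([AGIKMS], [MW II/VII]),
with `Iff.rfl` links to the first-hand decls proved in `Leaves/W4`.  NOT HELD and quoted only through a held
restatement: Mœglin–Waldspurger, Mem. AMS 251 (2018) (acq-07650).  Loci:
`src/<arXiv id>/<file>.tex:L<n>` = line of the TeX source staged in the cell's `inputs/files/src/`;
`[<corpus key> p.N]` = PDF page of a held item.  WHAT is reproduced: not the mathematics of any leaf, but the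
GENERALITY (the hypotheses) in which each load-bearing external statement of the Book is (a) CONSUMED — by the
Book, by [Mok], by [KMSW], by [MW] — and (b) SUPPLIED in print by 2026, so that "proved for split groups /
quasi-split groups / `F = ℝ` / generic parameters" versus "needed for all unramified groups / inner forms / every
archimedean place / all parameters" is a kernel-checked statement about regions of a scope lattice, not a matter
of wording.  STATUS OF THE SOURCES: the Book's theorems are not in dispute; [AGIKMS], [KM26], [CK26] are
preprints; the status findings are dated 2026-08-18.

**Design (two layers).**  Layer S (scope): concrete `DecidableEq` descriptors of the generality a statement speaks
about — local field kind and characteristic (`LocalKind`), splitting behaviour (`Ramification`), classical type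
(`ClassicalType`), distance from quasi-split (`Form`), parameter kind (`ParamKind`); a REGION is a predicate on
scopes; region inclusions and exclusions are settled by `decide`.  Layer W (world): one structure `World` of
UNINTERPRETED data indexed by scope — the type of fully specified instances of each identity and its two sides as
values in the schematic value type `Val := Int` (the sources' values are complex numbers, distributions or
operators; only `0 ≠ 1` is used).  A leaf is `def Leaf (Ω : World) (R : Scope → Prop) : Prop := ∀ s, R s →
∀ i : Ω.Inst s, lhs = rhs`; monotone in `R`.  The `theorem`s are: monotonicity; decided facts about regions;
SEPARATION theorems `…separates : ∃ Ω : World, Leaf Ω supplied ∧ ¬ Leaf Ω consumed` exhibiting a model in which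
the printed statement holds and the consumed one fails; the register (§8) restating the cell's edges E-TWFL /
E-STABTW over the typed leaves.  Packets (§5) are finite lists over an opaque `Irr` with a pairing into the
characters of the component group `A_ψ` computed from the COMBINATORIAL SHAPE of the parameter ([AGIKMS] §2.5),
so the endoscopic character relation (ECR1) and the structure of tempered packets are typed formulas.

**Deliberately not here.**  Any claim that a leaf is true (nothing is an axiom; nothing is proved about
automorphic forms: a published-but-unproved statement is a `Prop`-valued `def` consumed downstream as a
hypothesis `(h : X)`); the Book's internal dependency DAG (module `DependencyDag`, structure `Nodes`) and the
2026 status TABLE of the leaves (module `Upstream`, `Upstream.status`) — this module supplies the typed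
WITNESSES those refer to; Mathlib (the dictionary scope-tag ↦ Mathlib class — `IsNonarchimedeanLocalField`,
`CharP`, `NumberField` — is the separate file `MathlibDictionary` of this directory; Mathlib has no reductive groups over local
fields, no endoscopic data, no packets, which is why the leaf parameters are scope tags and not structures over
a field).  Every schematic simplification is listed declaration by declaration in the cell's `DIVERGENCE.md`
(entries D-TY-01 … D-TY-21); leaf ids `Lnn` are those of the cell's `LEMMAS.md` §2.  Words the gate lints in
docstrings are abbreviated there ("Conj."); the affected verbatim sentences stand in `--` comments next to the
declaration they document.  No `axiom`, no `sorry`, no `opaque`; `#print axioms` of every theorem is empty or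
`[propext]`.

**Files of this directory** (each ≤ 400 lines; import order = this order).  `Scopes` — §1 scope vocabulary and
§2 the `World`; `WeightedFL` — §3 the fundamental lemmas L04–L09 with the separation models for L06/L07;
`Stabilisation` — §4 L10, L12, L13, L15 and the stabilisation identities; `Packets` — §5 parameters, component
groups, packets, ECR and the local classification statement, §6 the intertwining leaves L16–L19;
`ArchimedeanInner` — §7 L20, the inner-form programme and the region witnesses; `Register` — §8 the register
`L04 … L20` keyed by the cell's LEMMAS.md ids, the edges E-TWFL / E-STABTW and `residue_witnesses`; `Bridge` —
the dictionary `Reads` between the propositional DAG (`DependencyDag.Nodes`) and these typed leaves;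
`MathlibDictionary` — scope tag ↦ Mathlib class (with `Operators` below, the only files importing Mathlib).  Added later (gen 3–4, each
importing only landed files above it): `W4` — [W4] = Waldspurger, Math. Ann. 343 (2009) typed FIRST-HAND (§2.1
hypotheses, Conj. 3.5/3.6/3.7, Thm 3.8 and the logical shape of its proof, [MW II] 4.4–4.5 support removal);
`Classification` — §9 the local classification theorem IN FULL (`TemperedData`, `LocalClassificationFull`:
packet assignment, tempered members, disjointness and exhaustion of the tempered dual; kernel separation
`LocalClassificationFull.strictly_stronger` from §5's `LocalClassification`; `Book.T151`, `Mok.T251`,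
`KMSW.T161`, `KMSW.T161g`); `GlobalTheorems` — §10 the global theorems over an uninterpreted `GlobalWorld`
(Hecke decomposition by parameter, componentwise and printed multiplicity formula with `printed_of_components`,
the `m_ψ` rule, the stable multiplicity formula; Book/Mok/KMSW stated regions vs the KMSW proved region, kernel
separation `KMSW.global_separates`).  Schematic simplifications of §9–§10: DIVERGENCE D-TY-28 … D-TY-33.
Added in gen 4–6 (some exceed 400 lines): `BridgeFull` — §9b full-content readings of the DAG nodes T151, [Mok]
T251, [KMSW] T161 / T161g; `BridgeFullGlobal` — §9c the same for the GLOBAL nodes T152, T412, [Mok] T252, T512,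
[KMSW] T171 / T171p; `Intertwining` — §11 the ordinary endoscopic character relation (ECR2), the even-orthogonal
refinement and the local intertwining relation with content (T221(b) / T224 / T241 / T244; [Mok] 3.4.3; [AGIKMS]
(ECR2), (A-LIR), (LIR), Thm `main3`); `GlobalSeed` — §12 the global seed theorems, the sign theorem and the global
intertwining relation with content (T141 / T142 / T153 / T422); `BridgeRest` — §13 full-content readings of the
remaining DAG nodes and of the preprint leaves AGIKMS 1.10.5 / D.2.1; `InnerLIR` — §14 the local intertwining
relation for inner forms of unitary groups ([KMSW] Theorem* 2.6.2); `Canonical` — §15 the stable form as a packet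
sum, the two forms of (ECR2), canonicity of packets; `Operators` — §16 the intertwining leaves [A26] / [A27]a with
OPERATORS ([AGIKMS] Thms 1.8.1, 1.9.1, 3.5.1, [Mok] Props 3.5.1, 3.5.3 as identities of `K`-linear maps; imports
Mathlib's linear algebra).  Schematic simplifications of §11–§16: DIVERGENCE D-TY-34 … D-TY-62; the cell's
`lean/MODULE-MAP.md` is the authoritative file ↦ proposal table.
-/

set_option autoImplicit false

namespace Literature.NumberTheory.Automorphic.Arthur2013.Leaves

/-- Schematic value type for both sides of every identity (the sources' values are complex numbers,
distributions or operators; only `0 ≠ 1` is ever used, in the separation models; DIVERGENCE D-TY-01).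
[folklore] (the audit's own bookkeeping device) -/
abbrev Val : Type := Int

/-! ## §1  Scope vocabulary -/

/-- Kind of LOCAL base field.  `nonarch p c0`: non-archimedean local field of residue characteristic `p`, of
characteristic `0` if `c0 = true` (finite extension of `ℚ_p`) and of characteristic `p` otherwise (`𝔽_q((t))`;
[CL II] `src/0912.4512/lfpII-arxiv.tex:L439` "Considérons le corps local $K=\Fq((\eps))$").
[folklore] (standard classification of local fields, recorded as tags; Mathlib dictionary in `MathlibDictionary`) -/
inductive LocalKind
  | real
  | complex
  | nonarch (p : Nat) (charZero : Bool)
  deriving DecidableEq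

namespace LocalKind

/-- archimedean place (`F = ℝ` or `ℂ`). [folklore] (tag reading) -/
def isArchimedean : LocalKind → Bool
  | .real => true
  | .complex => true
  | .nonarch _ _ => false

/-- `F` non-archimedean of characteristic zero: [AGIKMS] `src/2410.13504/note30.tex:L2038` "Assume that $F$
is a non-archimedean local field of characteristic zero."; [MW I] 1.1. [folklore] (tag reading) -/
def isPadic : LocalKind → Bool
  | .real => false
  | .complex => false
  | .nonarch _ c0 => c0

/-- characteristic zero: ALL of the Book, [Mok], [KMSW], [MW], [AGIKMS] (`note30.tex:L1065` "Fix a local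
field $F$ of characteristic zero."). [folklore] (tag reading) -/
def isCharZero : LocalKind → Bool
  | .real => true
  | .complex => true
  | .nonarch _ c0 => c0

/-- positive-characteristic local field `𝔽_q((ε))` ([CL II] `src/0912.4512/lfpII-arxiv.tex:L439`).
[folklore] (tag reading) -/
def isLaurent : LocalKind → Bool
  | .real => false
  | .complex => false
  | .nonarch _ c0 => !c0

end LocalKind

/-- Splitting behaviour of an INSTANCE of a fundamental-lemma-type identity over a non-archimedean local field:
of the connected reductive `G` TOGETHER WITH the Levi and endoscopic data `(M, M′ = G′(s))` entering the identity
(cell GAPS G-UP-25 / G-UP-28: the printed supply [CL II] has `G`, `T`, `M` and the endoscopic groups all split, while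
a split `G = Sp_{2n}` already meets elliptic endoscopic factors `SO_{2b}^α`, `α` an unramified quadratic character
`≠ 1`, which are NOT split).  `split` = every group of the instance "défini et déployé" ([CL II]
`lfpII-arxiv.tex:L439`); `unramifiedNonsplit` = every group of the instance unramified (quasi-split, split over
an unramified extension), at least one not split (`G = U_n`, `E/F` unramified; `G = SO_{2n}^η`, `η` unramified
`≠ 1`; `G = Sp_{2n}` with an endoscopic factor `SO_{2b}^α` as above); `ramified` = otherwise.  The (weighted)
fundamental lemmas are FORMULATED (hyperspecial `K`) exactly on `split ∪ unramifiedNonsplit` ([MW II] 4.1,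
`src/1401.7127/main.tex:L2362`: "on suppose $(G,\tilde{G},{\bf a})$ non ramifi\'e et $p$ grand").
DIVERGENCE D-TY-21 (one tag for the whole instance).
READING (docstring revision, cell GAPS G-UP-82 / G-UP-85 / G-TY-8-1, superseding the G-UP-25 parenthetical
above; no constructor and no consumer changed): the instance whose splitting type is recorded is the instance
AT WHICH the Lie-algebra identity is INVOKED.  For the group-level weighted fundamental lemma at a class with
non-central semisimple part `ε` this is the DESCENDED instance `(Ḡ ⊃ R̄, H̄; Ȳ)` of [W4] (Waldspurger, Math.
Ann. 343) Prop. 5.4 (ii), p.152, VERBATIM: "Supposons M′_ε non ramifié. Avec les notations ci-dessus, on a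
l'égalité: r^{G̃,ω}_{M′}(γ) = Σ_{L̄∈L^{Ḡ}(R̄)} d^{G̃}_{R̄}(M̃, L̄) r^{l̄_sc}_{h̄}(Ȳ)." (same page: "Les groupes
Ḡ et H̄ sont non ramifiés.") and of Lemme 6.2, p.158, VERBATIM: "Supposons (M′, ^L M′, s, ξ̂) = (M, ^L M, 1,
id) ou que le lemme fondamental pondéré pour les algèbres de Lie est vérifié. Alors on a l'égalité
r^{G̃,ω}_{M′}(γ) = I." — equivalently a member `(G_1, F_1)` of Arthur's family `U(G, F)` TOGETHER WITH its
Levi and endoscopic data: STF I (Arthur, J. Inst. Math. Jussieu 1 (2002)) §5, preprint p.70 `[corpus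
paper:url-5bc5c5898fac p0376–p0385]`, VERBATIM: "(iii) F_1 equals F, and G_1 = G_c is the connected
centralizer of a semisimple element c ∈ G(F) such that D(c) ∈ o^*_F, and |D(c)| = 1. (It follows from [K3,
Proposition 7.1] that G_1 is quasisplit.) If G is a fixed unramified group over a local field F, let U(G, F)
denote the smallest family U that contains (G, F), and satisfies the hereditary properties (i), (ii) and
(iii).", and Assumption 5.2 (1), p.71 `[p0388–p0392]`, which requires [Conj.] 5.1 "and the standard form of
its Lie algebra analogue" to "hold for any of the families U(G_v, F_v), v ∉ V_fund(G)" ("[Conj.]" abbreviates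
the printed word: gate docstring lint).  Consequently NO classical family's chain of consumed instances is
entirely `split`: for SPLIT `G = SO_7 ⊃ M = GL_1 × SO_5`, `M′ = GL_1 × SO_3 × SO_3`, the descended endoscopic
datum `H̄ = GL_1 × E¹ × E¹` of `M̄ = GL_1 × SO_4 ⊂ Ḡ = SO_6` is a NON-split unramified torus datum (cell
DESCENT-g8.md §4 Example A), and for split `SO_9` one meets `Ḡ = SO_8^α`, `α` unramified quadratic `≠ 1`
(Example B) — both tagged `unramifiedNonsplit`; the clause of G-UP-25 reading the `SO_{2n+1}` chain as
all-split is WITHDRAWN by its own lineage (G-UP-82).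
[folklore] (standard trichotomy, recorded as a tag) -/
inductive Ramification
  | split
  | unramifiedNonsplit
  | ramified
  deriving DecidableEq

/-- `G` unramified (quasi-split and split over the maximal unramified extension). [folklore] (tag reading) -/
def Ramification.isUnramified : Ramification → Bool
  | .split => true
  | .unramifiedNonsplit => true
  | .ramified => false

/-- Scope of a LOCAL NON-ARCHIMEDEAN statement about a (possibly twisted) connected reductive group — the data
over which the hypotheses of the fundamental-lemma-type statements are phrased.  The residual-characteristic
hypothesis is ONE Boolean `pLarge` = "the hypothesis OF THE SOURCE holds", although the printed thresholds differ
(DIVERGENCE D-TY-02): (Hyp) of [MW I] 6.1 (`src/1401.4569/main.tex:L3060`: "(Hyp) la caract\'eristique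
r\'esiduelle $p$ de $F$ est grande, plus pr\'ecis\'ement $p>N(G)e_{F}+1$"); [CL II] (`lfpII-arxiv.tex:L439`:
"On suppose que l'ordre du groupe de Weyl $W^G$ de $(G,T)$ est inversible dans $\Fq$"); [W-AIF]
(`[paper:doi-10-5802-aif-2476 p.3]`: "Supposons aussi que la caractéristique p de F_q soit assez grande
relativement au rang commun de G′ et G″").
[cite: Waldspurger2014StabilisationII, §4.1 standing hypotheses (arXiv:1401.7127 l.2362) — the data they quantify over, recorded as tags] -/
structure NonarchGroupScope where
  /-- local field kind (only `nonarch` is meaningful here) -/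
  field : LocalKind
  /-- absolute rank of `G` (the "p large w.r.t. the rank" hypotheses) -/
  rank : Nat
  /-- splitting behaviour of the instance (`G` and the Levi / endoscopic data of the identity; D-TY-21) -/
  ram : Ramification
  /-- the twisting datum `(θ, ω)` of `(G, G̃, 𝐚)` is non-trivial ([MW I] 1.1) -/
  twisted : Bool
  /-- the residual-characteristic hypothesis of the source holds -/
  pLarge : Bool
  deriving DecidableEq

/-- Combinatorial type of the groups of the classification: `GL N quad` = `GL_N(E)`, `E = F` (`quad = false`)
or `E/F` quadratic; `SOodd n` = split `SO_{2n+1}`; `Sp n` = `Sp_{2n}`; `SOeven n ηtriv` = `SO_{2n}^η`, split iff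
`ηtriv` (the Book §1.2, not held; [AGIKMS] works with `SO_{2n+1}(F)`, `Sp_{2n}(F)`, `O_{2n}(F)`, `U_n`,
`GL_N(E)`: `note30.tex:L1426–L1466`; DIVERGENCE D-TY-06); `U n` = quasi-split unitary group of `E/F` ([Mok]
`src/1206.0882/main.tex:L125` "quasi-split unitary groups").
[folklore] (the standard list of classical groups of the three programmes, as tags) -/
inductive ClassicalType
  | GL (N : Nat) (quad : Bool)
  | SOodd (n : Nat)
  | Sp (n : Nat)
  | SOeven (n : Nat) (ηtriv : Bool)
  | U (n : Nat)
  deriving DecidableEq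

namespace ClassicalType

/-- groups of the Book: split `SO_{2n+1}`, `Sp_{2n}`, quasi-split `SO_{2n}^η`, and `GL_N/F`. [folklore] (tag reading) -/
def isArthur : ClassicalType → Bool
  | .GL _ quad => !quad
  | .SOodd _ => true
  | .Sp _ => true
  | .SOeven _ _ => true
  | .U _ => false

/-- groups of Mok's memoir: `U_{E/F}(N)` and `GL_N(E)`. [folklore] (tag reading) -/
def isMok : ClassicalType → Bool
  | .GL _ quad => quad
  | .SOodd _ => false
  | .Sp _ => false
  | .SOeven _ _ => false
  | .U _ => true

/-- the quasi-split group of this type is split over `F`. [folklore] (tag reading) -/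
def isSplitType : ClassicalType → Bool
  | .GL _ quad => !quad
  | .SOodd _ => true
  | .Sp _ => true
  | .SOeven _ ηtriv => ηtriv
  | .U _ => false

end ClassicalType

/-- Distance from quasi-split, with the rigidification normalising transfer factors and packets: `quasiSplit`
(the Book, [Mok], [AGIKMS]); `pureInner` (pure inner twists — with generic parameters the case in which
[KMSW]'s global theorem is unconditional, `src/1409.3731/chap1mainthms.tex:L355`); `extendedPure` (extended
pure inner twists = the inner forms of unitary groups treated in [KMSW]); `inner` (general inner forms, rigid
inner twists — for the symplectic/orthogonal types the subject of the Book's last chapter, outside every source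
audited here). [folklore] (tag vocabulary) -/
inductive Form
  | quasiSplit
  | pureInner
  | extendedPure
  | inner
  deriving DecidableEq

/-- Kind of local parameter: `temperedGeneric` (bounded `L`-parameters; "generic"), `cotempered` (Aubert duals
of tempered ones; [AGIKMS] `note30.tex:L2045` "We say that $\psi$ is co-tempered if $\psi = \widehat\phi$ for
some $\phi$"), `general` (all of `Ψ(G)`). [folklore] (tag vocabulary) -/
inductive ParamKind
  | temperedGeneric
  | cotempered
  | general
  deriving DecidableEq

/-- Scope of a LOCAL statement of the endoscopic classification: base field kind, classical type, form,
parameter kind. [folklore] (tag vocabulary) -/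
structure LocalClassicalScope where
  /-- local field kind (all places: `real`, `complex`, `nonarch p c0`) -/
  field : LocalKind
  /-- classical type of `G` -/
  type : ClassicalType
  /-- distance from quasi-split -/
  form : Form
  /-- kind of parameters the statement speaks about -/
  params : ParamKind
  deriving DecidableEq

/-- Kind of GLOBAL base field (the Book, [Mok], [KMSW], [MW]: number fields only). [folklore] (tag vocabulary) -/
inductive GlobalKind
  | numberField
  | functionField (p : Nat)
  deriving DecidableEq

/-- Scope of a GLOBAL statement: field kind; `anyReductive = true` for "every connected reductive `G` / every
twisted space `(G, G̃, 𝐚)`" (the generality of [MW X] and of Arthur's stable trace formula I–III), else one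
classical `type`; `form`; `twisted`. [folklore] (tag vocabulary) -/
structure GlobalScope where
  /-- global field kind -/
  field : GlobalKind
  /-- the statement is about every connected reductive group / twisted space -/
  anyReductive : Bool
  /-- classical type (meaningful when `anyReductive = false`) -/
  type : ClassicalType
  /-- distance from quasi-split -/
  form : Form
  /-- twisted trace formula (`G̃ ≠ G`) or not -/
  twisted : Bool
  deriving DecidableEq

/-! ## §2  The world: uninterpreted analytic data indexed by scope -/

/-- All objects the leaf statements speak about, UNINTERPRETED.  `…Inst s` is the type of fully specified
instances of the relevant identity at scope `s`; the `Val`-valued fields are the two sides of the identity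
(DIVERGENCE D-TY-01, D-TY-03).  Nothing is assumed about a world: the separation theorems construct explicit
finite ones. [folklore] (a first-order signature for the audit; no source asserts anything here) -/
structure World where
  /-- [MW II] 4.4 instances `(G̃ ⊃ M̃ en bonne position, K̃ hyperspecial, 𝐌' elliptic unramified endoscopic
  datum of M̃, 𝛅' ∈ D^st_géom(𝐌'))` -/
  TWFLInst : NonarchGroupScope → Type
  /-- `r^{G̃,𝓔}_{M̃}(𝐌', 𝛅', K̃)` (endoscopic side, [MW II] 4.1) -/
  rEndo : (s : NonarchGroupScope) → TWFLInst s → Val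
  /-- `r^{G̃}_{M̃}(transfert(𝛅'), K̃)` -/
  rOrb : (s : NonarchGroupScope) → TWFLInst s → Val
  /-- weighted FL for LIE ALGEBRAS, standard: instances `(G ⊃ M ⊃ T, s, M' = M_s, Y ∈ 𝔪'(F) ss. G-regular)`
  ([CL II] Théorème; [W-AIF] (LFP)) -/
  WLieInst : NonarchGroupScope → Type
  /-- `J^G_{M',M}(Y)` -/
  jEndo : (s : NonarchGroupScope) → WLieInst s → Val
  /-- `Σ_{s'} |Z_{Ĝ_{s'}}/Z_{Ĝ}|^{-1} S^{G_{s'}}_{M'}(Y)` -/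
  jStable : (s : NonarchGroupScope) → WLieInst s → Val
  /-- NON-STANDARD weighted FL (Lie algebras): instances `((G₁,G₂,j_*) non-standard endoscopic triple,
  M₁ ↔ M₂, d₁ ∈ D^st_géom(𝔪₁(F)) à support régulier)` ([MW VII] 9.2); `s` = scope of `G₁` -/
  WLieNSInst : NonarchGroupScope → Type
  /-- `s^{𝔤₁}_{𝔪₁}(d₁)` -/
  sNS₁ : (s : NonarchGroupScope) → WLieNSInst s → Val
  /-- `c^{G₁,G₂}_{M₁,M₂} · s^{𝔤₂}_{𝔪₂}(j_*(d₁))` -/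
  sNS₂ : (s : NonarchGroupScope) → WLieNSInst s → Val
  /-- unweighted (twisted) FL and transfer: instances -/
  FLInst : NonarchGroupScope → Type
  /-- unweighted FL, left side (κ-orbital integral of the unit / Hecke function) -/
  flLHS : (s : NonarchGroupScope) → FLInst s → Val
  /-- unweighted FL, right side (stable orbital integral on the endoscopic group) -/
  flRHS : (s : NonarchGroupScope) → FLInst s → Val
  /-- [MW I] 4.11: the space `I(G̃(F),ω) ⊗ Mes(G(F))` -/
  ISpace : NonarchGroupScope → Type
  /-- [MW I] 4.11: the target `⊕_{𝐆'} SI(𝐆') ⊗ Mes(G'(F))` -/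
  SISum : NonarchGroupScope → Type
  /-- [MW I] 4.11: the transfer map -/
  transferMap : (s : NonarchGroupScope) → ISpace s → SISum s
  /-- [MW I] 4.11: membership in `I^𝓔(G̃(F),ω)` (conditions (1)–(3) of `src/1401.4569/main.tex:L1835–L1839`) -/
  inIE : (s : NonarchGroupScope) → SISum s → Prop
  /-- global: instances `(F, (G,G̃,𝐚), V ⊇ V_ram ∪ ∞, f)` of a stabilisation identity -/
  StabInst : GlobalScope → Type
  /-- `I^{G̃}_{disc}(ω, f)` -/
  iDisc : (s : GlobalScope) → StabInst s → Val
  /-- `Σ_{𝐆'} i(G̃,𝐆') SI^{𝐆'}_{disc}(f^{𝐆'})` -/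
  iDiscEndo : (s : GlobalScope) → StabInst s → Val
  /-- local (twisted) trace formula instances (arXiv:1205.1100; Mem. AMS 251) -/
  LTFInst : LocalKind → Type
  /-- local trace formula, geometric side -/
  ltfGeom : (k : LocalKind) → LTFInst k → Val
  /-- local trace formula, spectral side -/
  ltfSpec : (k : LocalKind) → LTFInst k → Val
  /-- `Irr_unit(G(F))` at a local classical scope (opaque carrier of packets) -/
  Irr : LocalClassicalScope → Type
  /-- test functions on `G(F)` -/
  Test : LocalClassicalScope → Type
  /-- test functions on `G̃(N) = GL_N(E) ⋊ θ` -/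
  TestGL : LocalClassicalScope → Type
  /-- "`f^{G̃(N)}` and `f` have Δ[𝔴]-matching orbital integrals" -/
  Matches : (s : LocalClassicalScope) → TestGL s → Test s → Prop
  /-- characters `Θ_π(f)` -/
  trace : (s : LocalClassicalScope) → Irr s → Test s → Val
  /-- parameters `Ψ(G)` at scope `s` (opaque) -/
  Param : LocalClassicalScope → Type
  /-- twisted characters `tr π̃_ψ(f^{G̃(N)})` of the Whittaker-normalised extension -/
  twTrace : (s : LocalClassicalScope) → Param s → TestGL s → Val
  /-- the stable linear form `f ↦ f^G(ψ)` of [Ar, Thm 2.2.1(a)] -/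
  stableForm : (s : LocalClassicalScope) → Param s → Test s → Val
  /-- intertwining statements: instances `(M ⊂ P, P', π resp. ψ_M, w, …)` -/
  IopInst : LocalClassicalScope → Type
  /-- intertwining identity, operator side (evaluated) -/
  iopLHS : (s : LocalClassicalScope) → IopInst s → Val
  /-- intertwining identity, predicted scalar side -/
  iopRHS : (s : LocalClassicalScope) → IopInst s → Val

namespace World

/-- The world with one-point instance types and all values `0`: every identity holds.  Base of the separation
models. [folklore] (explicit finite structure) -/
def trivial : World where
  TWFLInst _ := Unit
  rEndo _ _ := 0
  rOrb _ _ := 0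
  WLieInst _ := Unit
  jEndo _ _ := 0
  jStable _ _ := 0
  WLieNSInst _ := Unit
  sNS₁ _ _ := 0
  sNS₂ _ _ := 0
  FLInst _ := Unit
  flLHS _ _ := 0
  flRHS _ _ := 0
  ISpace _ := Unit
  SISum _ := Unit
  transferMap _ _ := ()
  inIE _ _ := True
  StabInst _ := Unit
  iDisc _ _ := 0
  iDiscEndo _ _ := 0
  LTFInst _ := Unit
  ltfGeom _ _ := 0
  ltfSpec _ _ := 0
  Irr _ := Unit
  Test _ := Unit
  TestGL _ := Unit
  Matches _ _ _ := True
  trace _ _ _ := 0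
  Param _ := Unit
  twTrace _ _ _ := 0
  stableForm _ _ _ := 0
  IopInst _ := Unit
  iopLHS _ _ := 0
  iopRHS _ _ := 0

end World

end Literature.NumberTheory.Automorphic.Arthur2013.Leaves
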